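import Literature.NumberTheory.QuadraticForms.IdeleSquareIndexProofs
import Literature.NumberTheory.QuadraticForms.QuadraticNormIndexLocal
import HarnessLib

/-!
# O'Meara 65:18a from the first inequality 65:14

Sibling proof file of `Literature.NumberTheory.QuadraticForms.SUnitSquareClasses` (namespace
`Literature.NumberTheory.QuadraticForms.OMeara65`), all declarations fully proved. It discharges
the named fact `isSquare_of_generators_places K` (O'Meara, *Introduction to quadratic forms*,
§65C Cor. 65:18a) *relative to* the first inequality `two_le_normIdeles_index K` (O'Meara 65:14,
`QuadraticNormIndex.lean`), following O'Meara's own four-line proof: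

* `isSquare_of_generators_places_of_two_le_normIdeles_index :
    two_le_normIdeles_index K → isSquare_of_generators_places K`;
* `isSquare_of_generators_places_of_ne_top` : the same from the only consequence of 65:14 that
  the proof uses, `principalIdeles K ⊔ normIdeles K θ ≠ ⊤` for every non-square `θ`.

With `IdeleSquareIndexProofs.normIdeles_index_dvd_two_of_facts'` this leaves the second
inequality `normIdeles_index_dvd_two K` resting on 65:14 (or just `J_K ≠ P_K N_{E/K} J_E`) and
65:18 (places separating the `S`-units modulo squares) alone
(`normIdeles_index_dvd_two_of_two_le_of_exists_places`,
`normIdeles_index_dvd_two_of_ne_top_of_exists_places`,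
`normIdeles_index_eq_two_of_ne_top_of_exists_places`).

## The argument (O'Meara §65C, proof of 65:18a, PDF pp. 188–189)

Conventions of §65A: `T ⊇` the dyadic places, `S = {v ∉ T}`, `J_K = P_K J_K^S`; generators
`ε_1, …, ε_s` of `𝔲 mod 𝔲²` and places `𝔭_1, …, 𝔭_s ∈ S` with `ε_i` a non-square at `𝔭_i` and a
square at the other `𝔭_j` (65:18). Let `α` be a square at all spots of `Ω - S` and a unit on
`S' = S - {𝔭_1, …, 𝔭_s}`, and suppose `α = θ` is a non-square; `E = K(√θ)`. It suffices to show
`J_K^S ⊆ P_K N_{E/K} J_E` (then `J_K = P_K J_K^S ⊆ P_K N_{E/K} J_E`, contradicting 65:14). For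
`i ∈ J_K^S` put `c_j = 1` if `i` is a non-square at `𝔭_j`, `0` otherwise, and
`ε = ∏ ε_j^{c_j} ∈ 𝔲`. At `𝔭_j` (non-dyadic) both `i_{𝔭_j}` and `ε` are units, and `ε` is a
non-square there exactly when `i_{𝔭_j}` is; as the units of `K_𝔭` have only two square classes
at a non-dyadic `𝔭` (`isSquare_mul_of_not_isSquare_of_valued_eq_one`), `(ε) i` is a square at
every `𝔭_j`. By Example 65:4 — local squares are local norms; at the places of `Ω - S`, where
`θ` is a local square, everything is a local norm; at `v ∈ S'` (non-dyadic, `θ` a unit) units are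
local norms (63:16) — `(ε) i ∈ N_{E/K} J_E`, so `i ∈ P_K N_{E/K} J_E`.

## References

* O. T. O'Meara, *Introduction to quadratic forms*, Grundlehren 117, Springer (1963), §65C
  Cor. 65:18a and its proof (PDF pp. 188–189), §65A Example 65:4, §63 (63:9, 63:16).
-/

noncomputable section

open NumberField IsDedekindDomain
open scoped Valued

namespace Literature.NumberTheory.QuadraticForms

/-! ### Two square classes of units at a non-dyadic place, in `K_v` -/

section NonDyadic

variable (K : Type*) [Field K] [NumberField K] (v : HeightOneSpectrum (𝓞 K))

/-- A square of the valuation ring `𝒪_v` is a square of `K_v`. [folklore] -/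
theorem isSquare_coe_of_isSquare_integer {u : 𝒪[v.adicCompletion K]} (h : IsSquare u) :
    IsSquare (u : v.adicCompletion K) := by
  obtain ⟨r, hr⟩ := h
  exact ⟨(r : v.adicCompletion K), by rw [hr]; rfl⟩

/-- If `x ∈ K_v` has valuation `1` and is a square in `K_v`, then it is the square of an element
of valuation `1`, hence a square of the valuation ring `𝒪_v`. [folklore] -/
theorem isSquare_integer_of_isSquare {x : v.adicCompletion K} (hx1 : Valued.v x = 1)
    (hx : IsSquare x) : IsSquare (⟨x, le_of_eq hx1⟩ : 𝒪[v.adicCompletion K]) := by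
  obtain ⟨s, hs⟩ := hx
  have hs1 : Valued.v s = 1 := by
    apply OMeara65.WithZeroMulInt.eq_one_of_mul_self
    rw [← map_mul, ← hs, hx1]
  exact ⟨⟨s, le_of_eq hs1⟩, Subtype.ext (by simpa using hs)⟩

/-- **Two square classes of units at a non-dyadic place** (O'Meara 63:9, units part:
`(𝔲_v : 𝔲_v²) = 2` for `v ∤ 2`): at a finite place `v` not above `2`, the product of two
non-square units of `K_v` is a square. (With `Δ` a unit of non-square residue, a unit `u` is a
square or `u Δ` is a square, `isSquare_or_isSquare_mul_of_isUnit`; so `x Δ` and `y Δ` are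
squares and `x y = (x Δ)(y Δ)/Δ²`.) [cite: Omeara1963, §63A Prop. 63:9] -/
theorem isSquare_mul_of_not_isSquare_of_valued_eq_one (h2 : (2 : 𝓞 K) ∉ v.asIdeal)
    {x y : v.adicCompletion K} (hx : Valued.v x = 1) (hy : Valued.v y = 1)
    (hxs : ¬ IsSquare x) (hys : ¬ IsSquare y) : IsSquare (x * y) := by
  obtain ⟨Δ, hΔ⟩ := exists_not_isSquare_residue K v h2
  have h2' := isUnit_two_integer_of_not_mem K v h2
  have hΔu : IsUnit Δ := by
    by_contra h
    apply hΔ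
    have h0 : IsLocalRing.residue 𝒪[v.adicCompletion K] Δ = 0 := by
      rw [IsLocalRing.residue_eq_zero_iff, IsLocalRing.mem_maximalIdeal, mem_nonunits_iff]
      exact h
    rw [h0]
    exact IsSquare.zero
  have hΔ0 : (Δ : v.adicCompletion K) ≠ 0 := by
    intro h0
    apply hΔu.ne_zero
    exact Subtype.ext h0
  set u : 𝒪[v.adicCompletion K] := ⟨x, le_of_eq hx⟩ with hu
  set w : 𝒪[v.adicCompletion K] := ⟨y, le_of_eq hy⟩ with hw
  have huu : IsUnit u := (isUnit_integer_iff K v u).2 hx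
  have hwu : IsUnit w := (isUnit_integer_iff K v w).2 hy
  have hux : IsSquare (u * Δ) := by
    rcases isSquare_or_isSquare_mul_of_isUnit K v h2' hΔ huu with h | h
    · exact absurd (isSquare_coe_of_isSquare_integer K v h) hxs
    · exact h
  have hwy : IsSquare (w * Δ) := by
    rcases isSquare_or_isSquare_mul_of_isUnit K v h2' hΔ hwu with h | h
    · exact absurd (isSquare_coe_of_isSquare_integer K v h) hys
    · exact h
  have hprod : IsSquare (x * (Δ : v.adicCompletion K) * (y * (Δ : v.adicCompletion K))) :=
    isSquare_coe_of_isSquare_integer K v (hux.mul hwy)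
  obtain ⟨t, ht⟩ := hprod
  refine ⟨t / (Δ : v.adicCompletion K), ?_⟩
  field_simp
  linear_combination ht

end NonDyadic

namespace OMeara65

variable (K : Type) [Field K] [NumberField K]

/-- **O'Meara 65:18a from `J_K ≠ P_K N_{E/K} J_E`.** The form of 65:18a in which the first
inequality enters only through its consequence `principalIdeles K ⊔ normIdeles K θ ≠ ⊤` for every
non-square `θ` (the one use O'Meara makes of 65:14 in the proof: "this conclusion is absurd since
`(J_F : P_F N_{E/F} J_E) ≥ 2`"); see `isSquare_of_generators_places_of_two_le_normIdeles_index`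
for the statement with 65:14 itself and for the argument.
[cite: Omeara1963, §65C Cor. 65:18a (proof)] -/
theorem isSquare_of_generators_places_of_ne_top
    (hne : ∀ a : K, ¬ IsSquare a →
      GaloisRepresentations.principalIdeles K ⊔ normIdeles K a ≠ ⊤) :
    isSquare_of_generators_places K := by
  intro T hT hadm ι _ hcard ε hgen p hpT hp α hαT hαinf hαS
  classical
  by_contra hns
  have hα0 : α ≠ 0 := by
    rintro rfl
    exact hns IsSquare.zero
  apply hne α hns
  -- it suffices that `J_K^S ≤ P_K N`
  rw [eq_top_iff, ← (isAdmissible_iff K T).1 hadm]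
  refine sup_le le_sup_left fun i hi ↦ ?_
  -- the correcting `S`-unit `e = ∏_{j : i non-square at p j} ε j`
  set c : ι → ℕ := fun j ↦ if IsSquare (ideleFiniteComponent K (p j) i : (p j).adicCompletion K)
    then 0 else 1 with hc
  set e : Kˣ := ∏ j, ε j ^ c j with he
  set u : Subgroup Kˣ := (↑T : Set (HeightOneSpectrum (𝓞 K))).unit K with hu
  have heu : e ∈ u := u.prod_mem fun j _ ↦ u.pow_mem (hgen.1 j) _
  set ιK : Kˣ →* GaloisRepresentations.ideleGroup K :=
    Units.map (algebraMap K (AdeleRing (𝓞 K) K) : K →* AdeleRing (𝓞 K) K) with hιK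
  -- `(e) i ∈ N`, hence `i = (e)⁻¹ ((e) i) ∈ P ⊔ N`
  suffices hN : ιK e * i ∈ normIdeles K α by
    have : i = (ιK e)⁻¹ * (ιK e * i) := by group
    rw [this]
    exact Subgroup.mul_mem _ (Subgroup.mem_sup_left (Subgroup.inv_mem _ ⟨e, rfl⟩))
      (Subgroup.mem_sup_right hN)
  refine mem_normIdeles_iff.2 ⟨fun v ↦ ?_, fun w ↦ ?_⟩
  · haveI : CharZero (v.adicCompletion K) :=
      charZero_of_injective_algebraMap (algebraMap K _).injective
    by_cases hvT : v ∈ T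
    · -- `α` is a local square at `v ∈ T`: everything is a norm
      rw [quadraticNormSubgroup_eq_top_of_isSquare (hαT v hvT) ((map_ne_zero _).2 hα0)]
      exact Subgroup.mem_top _
    have h2 : (2 : 𝓞 K) ∉ v.asIdeal := fun h ↦ hvT (hT v h)
    -- the component of `(e) i` at `v ∉ T` is a unit
    have hival : Valued.v (ideleFiniteComponent K v i : v.adicCompletion K) = 1 := hi v hvT
    have heval : Valued.v (ideleFiniteComponent K v (ιK e) : v.adicCompletion K) = 1 := by
      rw [hιK, ideleFiniteComponent_principal, Units.coe_map, MonoidHom.coe_coe,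
        GaloisRepresentations.valued_algebraMap_adicCompletion]
      exact heu v hvT
    have hprodval : Valued.v (ideleFiniteComponent K v (ιK e * i) : v.adicCompletion K) = 1 := by
      rw [map_mul, Units.val_mul, map_mul, heval, hival, mul_one]
    by_cases hvp : ∃ j, p j = v
    · -- `v = p j`: `(e) i` is a local square at `p j`
      obtain ⟨j, rfl⟩ := hvp
      refine mem_quadraticNormSubgroup_of_isSquare _ ?_
      rw [map_mul, Units.val_mul, hιK, ideleFiniteComponent_principal, Units.coe_map,
        MonoidHom.coe_coe]
      -- `e = ε j ^ c j * ∏_{k ≠ j} ε k ^ c k`, the second factor a square at `p j`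
      have hsq_rest : IsSquare (algebraMap K ((p j).adicCompletion K)
          ((∏ k ∈ Finset.univ.erase j, ε k ^ c k : Kˣ) : K)) := by
        rw [Units.coe_prod, map_prod]
        refine Finset.isSquare_prod _ fun k hk ↦ ?_
        rw [Units.val_pow_eq_pow_val, map_pow]
        exact ((hp k).2 j (Finset.ne_of_mem_erase hk).symm).pow _
      have he' : (e : K) = (ε j : K) ^ c j * ((∏ k ∈ Finset.univ.erase j, ε k ^ c k : Kˣ) : K) := by
        rw [he, ← Finset.mul_prod_erase Finset.univ (fun k ↦ ε k ^ c k) (Finset.mem_univ j),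
          Units.val_mul, Units.val_pow_eq_pow_val]
      rw [he', map_mul, mul_assoc, mul_comm _ (ideleFiniteComponent K (p j) i : (p j).adicCompletion K),
        ← mul_assoc]
      refine IsSquare.mul ?_ hsq_rest
      rw [map_pow]
      by_cases hsqi : IsSquare (ideleFiniteComponent K (p j) i : (p j).adicCompletion K)
      · have hcj : c j = 0 := by simp only [hc]; exact if_pos hsqi
        rw [hcj, pow_zero, one_mul]
        exact hsqi
      · have hcj : c j = 1 := by simp only [hc]; exact if_neg hsqi
        rw [hcj, pow_one]
        have hεval : Valued.v (algebraMap K ((p j).adicCompletion K) (ε j : K)) = 1 := by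
          rw [GaloisRepresentations.valued_algebraMap_adicCompletion]
          exact hgen.1 j (p j) (hpT j)
        exact isSquare_mul_of_not_isSquare_of_valued_eq_one K (p j) h2 hεval hival (hp j).1 hsqi
    · -- `v ∈ S'`: `α` and the component are units at the non-dyadic `v`
      push Not at hvp
      exact mem_quadraticNormSubgroup_of_valued_eq_one v h2 (hαS v hvT fun j ↦ hvp j) hprodval
  · haveI : CharZero w.Completion := charZero_of_injective_algebraMap (algebraMap K _).injective
    rw [quadraticNormSubgroup_eq_top_of_isSquare (hαinf w) ((map_ne_zero _).2 hα0)]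
    exact Subgroup.mem_top _

/-- **O'Meara 65:18a from the first inequality 65:14.** Under the conventions of §65A
(`T ⊇` dyadic places, `J_K = P_K J_K^S`), with generators `ε_1, …, ε_s` of `𝔲 mod 𝔲²` and places
`𝔭_1, …, 𝔭_s ∉ T` such that `ε_i` is a non-square at `𝔭_i` and a square at the other `𝔭_j`: an
`α ∈ K` which is a square at all places of `T` and at all infinite places, and a unit at every
finite `v ∉ T ∪ {𝔭_1, …, 𝔭_s}`, is a square in `K` — *provided* the first inequality
`(J_K : P_K N_{E/K} J_E) ≥ 2` (65:14, `two_le_normIdeles_index K`) holds. O'Meara's proof: were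
`α = θ` a non-square, every `S`-idèle `i` would lie in `P_K N_{E/K} J_E` for `E = K(√θ)` —
multiply `i` by the `S`-unit `ε = ∏ ε_j^{c_j}` (`c_j = 1` iff `i` is a non-square at `𝔭_j`) to
make it a local square at each `𝔭_j` (two square classes of units at the non-dyadic `𝔭_j`),
and apply Example 65:4 — whence `J_K = P_K J_K^S ⊆ P_K N_{E/K} J_E`, contradicting 65:14.
[cite: Omeara1963, §65C Cor. 65:18a (proof)] -/
theorem isSquare_of_generators_places_of_two_le_normIdeles_index
    (h14 : two_le_normIdeles_index K) : isSquare_of_generators_places K :=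
  isSquare_of_generators_places_of_ne_top K fun _ h ↦ ne_top_of_two_le_normIdeles_index h14 h

/-- **The second inequality from `J_K ≠ P_K N` and 65:18**: `normIdeles_index_dvd_two K` follows
from `principalIdeles K ⊔ normIdeles K θ ≠ ⊤` for all non-squares `θ` and
`exists_places_generators_nonsquare K` (65:18), by `isSquare_of_generators_places_of_ne_top` and
`IdeleSquareIndexProofs.normIdeles_index_dvd_two_of_facts'`.
[cite: Omeara1963, §65D Prop. 65:21 (proof)] -/
theorem normIdeles_index_dvd_two_of_ne_top_of_exists_places
    (hne : ∀ a : K, ¬ IsSquare a →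
      GaloisRepresentations.principalIdeles K ⊔ normIdeles K a ≠ ⊤)
    (h18 : exists_places_generators_nonsquare K) : normIdeles_index_dvd_two K :=
  normIdeles_index_dvd_two_of_facts' K h18 (isSquare_of_generators_places_of_ne_top K hne)

/-- **65:21 from `J_K ≠ P_K N` and 65:18**: an index dividing `2` (previous theorem) which is not
`1` equals `2`. [cite: Omeara1963, §65D Prop. 65:21] -/
theorem normIdeles_index_eq_two_of_ne_top_of_exists_places
    (hne : ∀ a : K, ¬ IsSquare a →
      GaloisRepresentations.principalIdeles K ⊔ normIdeles K a ≠ ⊤)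
    (h18 : exists_places_generators_nonsquare K) : normIdeles_index_eq_two K := fun a ha ↦ by
  rcases index_eq_one_or_eq_two_of_normIdeles_index_dvd_two
    (normIdeles_index_dvd_two_of_ne_top_of_exists_places K hne h18) ha with h | h
  · exact absurd (Subgroup.index_eq_one.1 h) (hne a ha)
  · exact h

/-- **The second inequality from 65:14 and 65:18**: `normIdeles_index_dvd_two K`
(`(J_K : P_K N_{E/K} J_E) ∣ 2` for every `E = K(√a)`) follows from the first inequality
`two_le_normIdeles_index K` (65:14) and `exists_places_generators_nonsquare K` (65:18) — 65:18a
being `isSquare_of_generators_places_of_two_le_normIdeles_index`, and the rest of O'Meara's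
proof of 65:21 being `IdeleSquareIndexProofs.normIdeles_index_dvd_two_of_facts'`.
[cite: Omeara1963, §65D Prop. 65:21 (proof)] -/
theorem normIdeles_index_dvd_two_of_two_le_of_exists_places (h14 : two_le_normIdeles_index K)
    (h18 : exists_places_generators_nonsquare K) : normIdeles_index_dvd_two K :=
  normIdeles_index_dvd_two_of_facts' K h18
    (isSquare_of_generators_places_of_two_le_normIdeles_index K h14)

/-- Hence, under 65:14 and 65:18, the full norm index theorem 65:21 `(J_K : P_K N_{E/K} J_E) = 2`.
[cite: Omeara1963, §65D Prop. 65:21] -/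
theorem normIdeles_index_eq_two_of_two_le_of_exists_places (h14 : two_le_normIdeles_index K)
    (h18 : exists_places_generators_nonsquare K) : normIdeles_index_eq_two K :=
  normIdeles_index_eq_two_of_dvd_two_of_two_le
    (normIdeles_index_dvd_two_of_two_le_of_exists_places K h14 h18) h14

end OMeara65

end Literature.NumberTheory.QuadraticForms
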